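import Summits.MatrixMultiplication.OmegaCensus.DominoZ11Z11Cells
import Summits.MatrixMultiplication.OmegaCensus.ThreeSetZ4Z4Cells
import Summits.MatrixMultiplication.OmegaCensus.DihedralLawModOneOrder25
import HarnessLib

/-!
# The `|A| ≡ 1 (mod 3)` law at `|A| = 121`: no law over `ℤ_11 × ℤ_11` (order `121` as one kernel theorem)

ω-census `pub-omega`, family (b3), seat pub-omega-group gen 38.  Framing: lottery ticket; floor = certified bounds/negative ranges.
VALUE: ONE kernel theorem for the census line `|A| = 121` of the classification of dihedral-like groups attaining the law
`3|S||T||U| + 8 = 8|A|` ('law ⟹ an element of order `≥ |A|/2`'; `ℤ_11²` is the only non-cyclic abelian group of order `121`) — assembled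
from existing kernel cells, no new computation; NOT progress on ω.

Proof of **`no_mod_one_law_z11_z11`** (same assembly as `DihedralLawModOneOrder325.no_mod_one_law_z5_z65`).  Every element of `ℤ_11²` has order
`≤ 11 < |A|/2`, so `A` is not two cosets of a cyclic subgroup (`two_cosets_of_mod_one_law_of_not_cube`: the parts are cube,
`(s,s | t,t | u,u)` with `3stu + 1 = 121`, `stu = 40` — `cube_factor_of_121`, `30` ordered factorisations); two parts `1`
(`card_le_two_mul_addOrderOf_of_two_two_law`) or a part `2` (`card_le_two_mul_addOrderOf_of_mod_one_law_card_four`) again give an element of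
order `≥ |A|/2`; the remaining shapes are the census cells `(1,4,10)` (`no_law_cube_14e_of_onto_z11z11`), `(1,5,8)` (`no_law_cube_15e_of_onto_z11z11`) in all orderings
(`no_law_cube_two_parts_of_ordered`).
-/

namespace Summit.MatrixMultiplication.OmegaCensus

open Literature.Combinatorics.Additive Finset

/-! ## Arithmetic: the ordered factorisations of `40` -/

section Arith

/-- The cube part sizes at `|A| = 121`: `cde = 40`, all `30` ordered factorisations. [folklore] -/
theorem cube_factor_of_121 {c d e : ℕ} (h : 3 * (c * d * e) + 1 = 121) :
    (c = 1 ∧ d = 1 ∧ e = 40) ∨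
      (c = 1 ∧ d = 2 ∧ e = 20) ∨
      (c = 1 ∧ d = 4 ∧ e = 10) ∨
      (c = 1 ∧ d = 5 ∧ e = 8) ∨
      (c = 1 ∧ d = 8 ∧ e = 5) ∨
      (c = 1 ∧ d = 10 ∧ e = 4) ∨
      (c = 1 ∧ d = 20 ∧ e = 2) ∨
      (c = 1 ∧ d = 40 ∧ e = 1) ∨
      (c = 2 ∧ d = 1 ∧ e = 20) ∨
      (c = 2 ∧ d = 2 ∧ e = 10) ∨
      (c = 2 ∧ d = 4 ∧ e = 5) ∨
      (c = 2 ∧ d = 5 ∧ e = 4) ∨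
      (c = 2 ∧ d = 10 ∧ e = 2) ∨
      (c = 2 ∧ d = 20 ∧ e = 1) ∨
      (c = 4 ∧ d = 1 ∧ e = 10) ∨
      (c = 4 ∧ d = 2 ∧ e = 5) ∨
      (c = 4 ∧ d = 5 ∧ e = 2) ∨
      (c = 4 ∧ d = 10 ∧ e = 1) ∨
      (c = 5 ∧ d = 1 ∧ e = 8) ∨
      (c = 5 ∧ d = 2 ∧ e = 4) ∨
      (c = 5 ∧ d = 4 ∧ e = 2) ∨
      (c = 5 ∧ d = 8 ∧ e = 1) ∨
      (c = 8 ∧ d = 1 ∧ e = 5) ∨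
      (c = 8 ∧ d = 5 ∧ e = 1) ∨
      (c = 10 ∧ d = 1 ∧ e = 4) ∨
      (c = 10 ∧ d = 2 ∧ e = 2) ∨
      (c = 10 ∧ d = 4 ∧ e = 1) ∨
      (c = 20 ∧ d = 1 ∧ e = 2) ∨
      (c = 20 ∧ d = 2 ∧ e = 1) ∨
      (c = 40 ∧ d = 1 ∧ e = 1) := by
  have hcde : c * (d * e) = 40 := by rw [← mul_assoc]; omega
  have hc : c ∈ Nat.divisors 40 := Nat.mem_divisors.2 ⟨Dvd.intro _ hcde, by norm_num⟩
  have hd : d ∈ Nat.divisors 40 :=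
    Nat.mem_divisors.2 ⟨Dvd.intro (c * e) (by rw [← hcde]; ring), by norm_num⟩
  rw [show Nat.divisors 40 = {1, 2, 4, 5, 8, 10, 20, 40} from by decide] at hc hd
  simp only [Finset.mem_insert, Finset.mem_singleton] at hc hd
  rcases hc with rfl | rfl | rfl | rfl | rfl | rfl | rfl | rfl <;> rcases hd with rfl | rfl | rfl | rfl | rfl | rfl | rfl | rfl
  · have he : e = 40 := by omega
    exact Or.inl ⟨rfl, rfl, he⟩
  · have he : e = 20 := by omega
    exact Or.inr (Or.inl ⟨rfl, rfl, he⟩)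
  · have he : e = 10 := by omega
    exact Or.inr (Or.inr (Or.inl ⟨rfl, rfl, he⟩))
  · have he : e = 8 := by omega
    exact Or.inr (Or.inr (Or.inr (Or.inl ⟨rfl, rfl, he⟩)))
  · have he : e = 5 := by omega
    exact Or.inr (Or.inr (Or.inr (Or.inr (Or.inl ⟨rfl, rfl, he⟩))))
  · have he : e = 4 := by omega
    exact Or.inr (Or.inr (Or.inr (Or.inr (Or.inr (Or.inl ⟨rfl, rfl, he⟩)))))
  · have he : e = 2 := by omega
    exact Or.inr (Or.inr (Or.inr (Or.inr (Or.inr (Or.inr (Or.inl ⟨rfl, rfl, he⟩))))))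
  · have he : e = 1 := by omega
    exact Or.inr (Or.inr (Or.inr (Or.inr (Or.inr (Or.inr (Or.inr (Or.inl ⟨rfl, rfl, he⟩)))))))
  · have he : e = 20 := by omega
    exact Or.inr (Or.inr (Or.inr (Or.inr (Or.inr (Or.inr (Or.inr (Or.inr (Or.inl ⟨rfl, rfl, he⟩))))))))
  · have he : e = 10 := by omega
    exact Or.inr (Or.inr (Or.inr (Or.inr (Or.inr (Or.inr (Or.inr (Or.inr (Or.inr (Or.inl ⟨rfl, rfl, he⟩)))))))))
  · have he : e = 5 := by omega
    exact Or.inr (Or.inr (Or.inr (Or.inr (Or.inr (Or.inr (Or.inr (Or.inr (Or.inr (Or.inr (Or.inl ⟨rfl, rfl, he⟩))))))))))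
  · have he : e = 4 := by omega
    exact Or.inr (Or.inr (Or.inr (Or.inr (Or.inr (Or.inr (Or.inr (Or.inr (Or.inr (Or.inr (Or.inr (Or.inl ⟨rfl, rfl, he⟩)))))))))))
  · omega
  · have he : e = 2 := by omega
    exact Or.inr (Or.inr (Or.inr (Or.inr (Or.inr (Or.inr (Or.inr (Or.inr (Or.inr (Or.inr (Or.inr (Or.inr (Or.inl ⟨rfl, rfl, he⟩))))))))))))
  · have he : e = 1 := by omega
    exact Or.inr (Or.inr (Or.inr (Or.inr (Or.inr (Or.inr (Or.inr (Or.inr (Or.inr (Or.inr (Or.inr (Or.inr (Or.inr (Or.inl ⟨rfl, rfl, he⟩)))))))))))))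
  · omega
  · have he : e = 10 := by omega
    exact Or.inr (Or.inr (Or.inr (Or.inr (Or.inr (Or.inr (Or.inr (Or.inr (Or.inr (Or.inr (Or.inr (Or.inr (Or.inr (Or.inr (Or.inl ⟨rfl, rfl, he⟩))))))))))))))
  · have he : e = 5 := by omega
    exact Or.inr (Or.inr (Or.inr (Or.inr (Or.inr (Or.inr (Or.inr (Or.inr (Or.inr (Or.inr (Or.inr (Or.inr (Or.inr (Or.inr (Or.inr (Or.inl ⟨rfl, rfl, he⟩)))))))))))))))
  · omega
  · have he : e = 2 := by omega
    exact Or.inr (Or.inr (Or.inr (Or.inr (Or.inr (Or.inr (Or.inr (Or.inr (Or.inr (Or.inr (Or.inr (Or.inr (Or.inr (Or.inr (Or.inr (Or.inr (Or.inl ⟨rfl, rfl, he⟩))))))))))))))))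
  · omega
  · have he : e = 1 := by omega
    exact Or.inr (Or.inr (Or.inr (Or.inr (Or.inr (Or.inr (Or.inr (Or.inr (Or.inr (Or.inr (Or.inr (Or.inr (Or.inr (Or.inr (Or.inr (Or.inr (Or.inr (Or.inl ⟨rfl, rfl, he⟩)))))))))))))))))
  · omega
  · omega
  · have he : e = 8 := by omega
    exact Or.inr (Or.inr (Or.inr (Or.inr (Or.inr (Or.inr (Or.inr (Or.inr (Or.inr (Or.inr (Or.inr (Or.inr (Or.inr (Or.inr (Or.inr (Or.inr (Or.inr (Or.inr (Or.inl ⟨rfl, rfl, he⟩))))))))))))))))))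
  · have he : e = 4 := by omega
    exact Or.inr (Or.inr (Or.inr (Or.inr (Or.inr (Or.inr (Or.inr (Or.inr (Or.inr (Or.inr (Or.inr (Or.inr (Or.inr (Or.inr (Or.inr (Or.inr (Or.inr (Or.inr (Or.inr (Or.inl ⟨rfl, rfl, he⟩)))))))))))))))))))
  · have he : e = 2 := by omega
    exact Or.inr (Or.inr (Or.inr (Or.inr (Or.inr (Or.inr (Or.inr (Or.inr (Or.inr (Or.inr (Or.inr (Or.inr (Or.inr (Or.inr (Or.inr (Or.inr (Or.inr (Or.inr (Or.inr (Or.inr (Or.inl ⟨rfl, rfl, he⟩))))))))))))))))))))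
  · omega
  · have he : e = 1 := by omega
    exact Or.inr (Or.inr (Or.inr (Or.inr (Or.inr (Or.inr (Or.inr (Or.inr (Or.inr (Or.inr (Or.inr (Or.inr (Or.inr (Or.inr (Or.inr (Or.inr (Or.inr (Or.inr (Or.inr (Or.inr (Or.inr (Or.inl ⟨rfl, rfl, he⟩)))))))))))))))))))))
  · omega
  · omega
  · omega
  · have he : e = 5 := by omega
    exact Or.inr (Or.inr (Or.inr (Or.inr (Or.inr (Or.inr (Or.inr (Or.inr (Or.inr (Or.inr (Or.inr (Or.inr (Or.inr (Or.inr (Or.inr (Or.inr (Or.inr (Or.inr (Or.inr (Or.inr (Or.inr (Or.inr (Or.inl ⟨rfl, rfl, he⟩))))))))))))))))))))))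
  · omega
  · omega
  · have he : e = 1 := by omega
    exact Or.inr (Or.inr (Or.inr (Or.inr (Or.inr (Or.inr (Or.inr (Or.inr (Or.inr (Or.inr (Or.inr (Or.inr (Or.inr (Or.inr (Or.inr (Or.inr (Or.inr (Or.inr (Or.inr (Or.inr (Or.inr (Or.inr (Or.inr (Or.inl ⟨rfl, rfl, he⟩)))))))))))))))))))))))
  · omega
  · omega
  · omega
  · omega
  · have he : e = 4 := by omega
    exact Or.inr (Or.inr (Or.inr (Or.inr (Or.inr (Or.inr (Or.inr (Or.inr (Or.inr (Or.inr (Or.inr (Or.inr (Or.inr (Or.inr (Or.inr (Or.inr (Or.inr (Or.inr (Or.inr (Or.inr (Or.inr (Or.inr (Or.inr (Or.inr (Or.inl ⟨rfl, rfl, he⟩))))))))))))))))))))))))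
  · have he : e = 2 := by omega
    exact Or.inr (Or.inr (Or.inr (Or.inr (Or.inr (Or.inr (Or.inr (Or.inr (Or.inr (Or.inr (Or.inr (Or.inr (Or.inr (Or.inr (Or.inr (Or.inr (Or.inr (Or.inr (Or.inr (Or.inr (Or.inr (Or.inr (Or.inr (Or.inr (Or.inr (Or.inl ⟨rfl, rfl, he⟩)))))))))))))))))))))))))
  · have he : e = 1 := by omega
    exact Or.inr (Or.inr (Or.inr (Or.inr (Or.inr (Or.inr (Or.inr (Or.inr (Or.inr (Or.inr (Or.inr (Or.inr (Or.inr (Or.inr (Or.inr (Or.inr (Or.inr (Or.inr (Or.inr (Or.inr (Or.inr (Or.inr (Or.inr (Or.inr (Or.inr (Or.inr (Or.inl ⟨rfl, rfl, he⟩))))))))))))))))))))))))))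
  · omega
  · omega
  · omega
  · omega
  · omega
  · have he : e = 2 := by omega
    exact Or.inr (Or.inr (Or.inr (Or.inr (Or.inr (Or.inr (Or.inr (Or.inr (Or.inr (Or.inr (Or.inr (Or.inr (Or.inr (Or.inr (Or.inr (Or.inr (Or.inr (Or.inr (Or.inr (Or.inr (Or.inr (Or.inr (Or.inr (Or.inr (Or.inr (Or.inr (Or.inr (Or.inl ⟨rfl, rfl, he⟩)))))))))))))))))))))))))))
  · have he : e = 1 := by omega
    exact Or.inr (Or.inr (Or.inr (Or.inr (Or.inr (Or.inr (Or.inr (Or.inr (Or.inr (Or.inr (Or.inr (Or.inr (Or.inr (Or.inr (Or.inr (Or.inr (Or.inr (Or.inr (Or.inr (Or.inr (Or.inr (Or.inr (Or.inr (Or.inr (Or.inr (Or.inr (Or.inr (Or.inr (Or.inl ⟨rfl, rfl, he⟩))))))))))))))))))))))))))))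
  · omega
  · omega
  · omega
  · omega
  · omega
  · omega
  · have he : e = 1 := by omega
    exact Or.inr (Or.inr (Or.inr (Or.inr (Or.inr (Or.inr (Or.inr (Or.inr (Or.inr (Or.inr (Or.inr (Or.inr (Or.inr (Or.inr (Or.inr (Or.inr (Or.inr (Or.inr (Or.inr (Or.inr (Or.inr (Or.inr (Or.inr (Or.inr (Or.inr (Or.inr (Or.inr (Or.inr (Or.inr (⟨rfl, rfl, he⟩)))))))))))))))))))))))))))))
  · omega
  · omega
  · omega
  · omega
  · omega
  · omega
  · omega

end Arith

/-! ## Assembly -/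

section DihedralLike

variable {G : Type} [Group G] [DecidableEq G] {S T U : Finset G}

/-- **ORDER 121: no dihedral-like group over `ℤ_11 × ℤ_11` (any presentation constant `c₀`; for `c₀ = 0` this is `Dih(ℤ_11²)`) has a TPP
triple attaining the law `3|S||T||U| + 8 = 8|A|`.** [folklore] -/
theorem no_mod_one_law_z11_z11 {ρ τ : ZMod 11 × ZMod 11 → G} {c₀ : ZMod 11 × ZMod 11}
    (hρρ : ∀ a b, ρ a * ρ b = ρ (a + b)) (hρτ : ∀ a b, ρ a * τ b = τ (b - a))
    (hτρ : ∀ a b, τ a * ρ b = τ (a + b)) (hττ : ∀ a b, τ a * τ b = ρ (c₀ + b - a))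
    (hρ : Function.Injective ρ) (hτ : Function.Injective τ) (hne : ∀ a b, ρ a ≠ τ b)
    (hsurj : ∀ g, (∃ a, ρ a = g) ∨ (∃ a, τ a = g)) (h : TripleProductProperty S T U) :
    3 * (S.card * T.card * U.card) + 8 ≠ 8 * Fintype.card (ZMod 11 × ZMod 11) := by
  intro hV
  have hA : Fintype.card (ZMod 11 × ZMod 11) = 121 := by rw [Fintype.card_prod, ZMod.card]
  have hp : ∀ q : ZMod 11 × ZMod 11, 11 • q = 0 := by
    intro q
    refine Prod.ext ?_ ?_
    · show 11 • q.1 = 0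
      rw [nsmul_eq_mul, show ((11 : ℕ) : ZMod 11) = 0 from by decide, zero_mul]
    · show 11 • q.2 = 0
      rw [nsmul_eq_mul, show ((11 : ℕ) : ZMod 11) = 0 from by decide, zero_mul]
  have big : ¬ ∃ g : ZMod 11 × ZMod 11, Fintype.card (ZMod 11 × ZMod 11) ≤ 2 * addOrderOf g := by
    rintro ⟨g, hg⟩
    have hle : addOrderOf g ≤ 11 := Nat.le_of_dvd (by norm_num) (addOrderOf_dvd_of_nsmul_eq_zero (hp g))
    rw [hA] at hg
    omega
  have hmod : Fintype.card (ZMod 11 × ZMod 11) % 3 = 1 := by rw [hA]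
  have hA14 : 14 ≤ Fintype.card (ZMod 11 × ZMod 11) := by rw [hA]; norm_num
  have hA7 : 7 ≤ Fintype.card (ZMod 11 × ZMod 11) := by omega
  have hV_TUS : 3 * (T.card * U.card * S.card) + 8 = 8 * Fintype.card (ZMod 11 × ZMod 11) := by
    rw [show T.card * U.card * S.card = S.card * T.card * U.card by ring]; exact hV
  have hV_UST : 3 * (U.card * S.card * T.card) + 8 = 8 * Fintype.card (ZMod 11 × ZMod 11) := by
    rw [show U.card * S.card * T.card = S.card * T.card * U.card by ring]; exact hV
  have hTUS : TripleProductProperty T U S := h.rotate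
  have hUST : TripleProductProperty U S T := h.rotate.rotate
  by_cases hnc : ((univ.filter fun a : ZMod 11 × ZMod 11 => ρ a ∈ S).card = (univ.filter fun a : ZMod 11 × ZMod 11 => τ a ∈ S).card ∧
      (univ.filter fun a : ZMod 11 × ZMod 11 => ρ a ∈ T).card = (univ.filter fun a : ZMod 11 × ZMod 11 => τ a ∈ T).card ∧
      (univ.filter fun a : ZMod 11 × ZMod 11 => ρ a ∈ U).card = (univ.filter fun a : ZMod 11 × ZMod 11 => τ a ∈ U).card)
  · obtain ⟨hS', hT', hU'⟩ := hnc
    have cS := card_eq_parts' hρ hτ hne hsurj S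
    have cT := card_eq_parts' hρ hτ hne hsurj T
    have cU := card_eq_parts' hρ hτ hne hsurj U
    set s₀ := (univ.filter fun a : ZMod 11 × ZMod 11 => ρ a ∈ S).card with hs₀
    set t₀ := (univ.filter fun a : ZMod 11 × ZMod 11 => ρ a ∈ T).card with ht₀
    set u₀ := (univ.filter fun a : ZMod 11 × ZMod 11 => ρ a ∈ U).card with hu₀
    have eS : S.card = 2 * s₀ := by rw [cS, ← hS']; ring
    have eT : T.card = 2 * t₀ := by rw [cT, ← hT']; ring
    have eU : U.card = 2 * u₀ := by rw [cU, ← hU']; ring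
    have hprod : 3 * (s₀ * t₀ * u₀) + 1 = 121 := by
      rw [eS, eT, eU, hA] at hV; nlinarith
    rcases cube_factor_of_121 hprod with ⟨h1, h2, h3⟩ | ⟨h1, h2, h3⟩ | ⟨h1, h2, h3⟩ | ⟨h1, h2, h3⟩ | ⟨h1, h2, h3⟩ | ⟨h1, h2, h3⟩ | ⟨h1, h2, h3⟩ | ⟨h1, h2, h3⟩ | ⟨h1, h2, h3⟩ | ⟨h1, h2, h3⟩ | ⟨h1, h2, h3⟩ | ⟨h1, h2, h3⟩ | ⟨h1, h2, h3⟩ | ⟨h1, h2, h3⟩ | ⟨h1, h2, h3⟩ | ⟨h1, h2, h3⟩ | ⟨h1, h2, h3⟩ | ⟨h1, h2, h3⟩ | ⟨h1, h2, h3⟩ | ⟨h1, h2, h3⟩ | ⟨h1, h2, h3⟩ | ⟨h1, h2, h3⟩ | ⟨h1, h2, h3⟩ | ⟨h1, h2, h3⟩ | ⟨h1, h2, h3⟩ | ⟨h1, h2, h3⟩ | ⟨h1, h2, h3⟩ | ⟨h1, h2, h3⟩ | ⟨h1, h2, h3⟩ | ⟨h1, h2, h3⟩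
    · -- (1,1,40)
      exact big (card_le_two_mul_addOrderOf_of_two_two_law hρρ hρτ hτρ hττ hρ hτ hne hsurj hmod hA7 h (by rw [eS, h1]) (by rw [eT, h2]) hV)
    · -- (1,2,20)
      exact big (card_le_two_mul_addOrderOf_of_mod_one_law_card_four hρρ hρτ hτρ hττ hρ hτ hne hsurj hmod hA14 h hV (by rw [eT, h2]))
    · -- (1,4,10)
      exact absurd hV (no_law_cube_two_parts_of_ordered 1 4 (fun h' hS₀ hS₁ hT₀ hT₁ hU'' hV'' => no_law_cube_14e_of_onto_z11z11 hρρ hρτ hτρ hττ hρ hτ hne hsurj (AddMonoidHom.id (ZMod 11 × ZMod 11)) Function.surjective_id h' hS₀ hS₁ hT₀ hT₁ hU'' hV'') h hS' hT' hU'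
        (Or.inl ⟨h1, h2⟩))
    · -- (1,5,8)
      exact absurd hV (no_law_cube_two_parts_of_ordered 1 5 (fun h' hS₀ hS₁ hT₀ hT₁ hU'' hV'' => no_law_cube_15e_of_onto_z11z11 hρρ hρτ hτρ hττ hρ hτ hne hsurj (AddMonoidHom.id (ZMod 11 × ZMod 11)) Function.surjective_id h' hS₀ hS₁ hT₀ hT₁ hU'' hV'') h hS' hT' hU'
        (Or.inl ⟨h1, h2⟩))
    · -- (1,8,5)
      exact absurd hV (no_law_cube_two_parts_of_ordered 1 5 (fun h' hS₀ hS₁ hT₀ hT₁ hU'' hV'' => no_law_cube_15e_of_onto_z11z11 hρρ hρτ hτρ hττ hρ hτ hne hsurj (AddMonoidHom.id (ZMod 11 × ZMod 11)) Function.surjective_id h' hS₀ hS₁ hT₀ hT₁ hU'' hV'') h hS' hT' hU'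
        (Or.inr (Or.inr (Or.inr (Or.inr (Or.inr (⟨h3, h1⟩)))))))
    · -- (1,10,4)
      exact absurd hV (no_law_cube_two_parts_of_ordered 1 4 (fun h' hS₀ hS₁ hT₀ hT₁ hU'' hV'' => no_law_cube_14e_of_onto_z11z11 hρρ hρτ hτρ hττ hρ hτ hne hsurj (AddMonoidHom.id (ZMod 11 × ZMod 11)) Function.surjective_id h' hS₀ hS₁ hT₀ hT₁ hU'' hV'') h hS' hT' hU'
        (Or.inr (Or.inr (Or.inr (Or.inr (Or.inr (⟨h3, h1⟩)))))))
    · -- (1,20,2)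
      exact big (card_le_two_mul_addOrderOf_of_mod_one_law_card_four hρρ hρτ hτρ hττ hρ hτ hne hsurj hmod hA14 hTUS hV_TUS (by rw [eU, h3]))
    · -- (1,40,1)
      exact big (card_le_two_mul_addOrderOf_of_two_two_law hρρ hρτ hτρ hττ hρ hτ hne hsurj hmod hA7 hUST (by rw [eU, h3]) (by rw [eS, h1]) hV_UST)
    · -- (2,1,20)
      exact big (card_le_two_mul_addOrderOf_of_mod_one_law_card_four hρρ hρτ hτρ hττ hρ hτ hne hsurj hmod hA14 hUST hV_UST (by rw [eS, h1]))
    · -- (2,2,10)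
      exact big (card_le_two_mul_addOrderOf_of_mod_one_law_card_four hρρ hρτ hτρ hττ hρ hτ hne hsurj hmod hA14 h hV (by rw [eT, h2]))
    · -- (2,4,5)
      exact big (card_le_two_mul_addOrderOf_of_mod_one_law_card_four hρρ hρτ hτρ hττ hρ hτ hne hsurj hmod hA14 hUST hV_UST (by rw [eS, h1]))
    · -- (2,5,4)
      exact big (card_le_two_mul_addOrderOf_of_mod_one_law_card_four hρρ hρτ hτρ hττ hρ hτ hne hsurj hmod hA14 hUST hV_UST (by rw [eS, h1]))
    · -- (2,10,2)
      exact big (card_le_two_mul_addOrderOf_of_mod_one_law_card_four hρρ hρτ hτρ hττ hρ hτ hne hsurj hmod hA14 hUST hV_UST (by rw [eS, h1]))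
    · -- (2,20,1)
      exact big (card_le_two_mul_addOrderOf_of_mod_one_law_card_four hρρ hρτ hτρ hττ hρ hτ hne hsurj hmod hA14 hUST hV_UST (by rw [eS, h1]))
    · -- (4,1,10)
      exact absurd hV (no_law_cube_two_parts_of_ordered 1 4 (fun h' hS₀ hS₁ hT₀ hT₁ hU'' hV'' => no_law_cube_14e_of_onto_z11z11 hρρ hρτ hτρ hττ hρ hτ hne hsurj (AddMonoidHom.id (ZMod 11 × ZMod 11)) Function.surjective_id h' hS₀ hS₁ hT₀ hT₁ hU'' hV'') h hS' hT' hU'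
        (Or.inr (Or.inr (Or.inr (Or.inl ⟨h1, h2⟩)))))
    · -- (4,2,5)
      exact big (card_le_two_mul_addOrderOf_of_mod_one_law_card_four hρρ hρτ hτρ hττ hρ hτ hne hsurj hmod hA14 h hV (by rw [eT, h2]))
    · -- (4,5,2)
      exact big (card_le_two_mul_addOrderOf_of_mod_one_law_card_four hρρ hρτ hτρ hττ hρ hτ hne hsurj hmod hA14 hTUS hV_TUS (by rw [eU, h3]))
    · -- (4,10,1)
      exact absurd hV (no_law_cube_two_parts_of_ordered 1 4 (fun h' hS₀ hS₁ hT₀ hT₁ hU'' hV'' => no_law_cube_14e_of_onto_z11z11 hρρ hρτ hτρ hττ hρ hτ hne hsurj (AddMonoidHom.id (ZMod 11 × ZMod 11)) Function.surjective_id h' hS₀ hS₁ hT₀ hT₁ hU'' hV'') h hS' hT' hU'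
        (Or.inr (Or.inr (Or.inl ⟨h3, h1⟩))))
    · -- (5,1,8)
      exact absurd hV (no_law_cube_two_parts_of_ordered 1 5 (fun h' hS₀ hS₁ hT₀ hT₁ hU'' hV'' => no_law_cube_15e_of_onto_z11z11 hρρ hρτ hτρ hττ hρ hτ hne hsurj (AddMonoidHom.id (ZMod 11 × ZMod 11)) Function.surjective_id h' hS₀ hS₁ hT₀ hT₁ hU'' hV'') h hS' hT' hU'
        (Or.inr (Or.inr (Or.inr (Or.inl ⟨h1, h2⟩)))))
    · -- (5,2,4)
      exact big (card_le_two_mul_addOrderOf_of_mod_one_law_card_four hρρ hρτ hτρ hττ hρ hτ hne hsurj hmod hA14 h hV (by rw [eT, h2]))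
    · -- (5,4,2)
      exact big (card_le_two_mul_addOrderOf_of_mod_one_law_card_four hρρ hρτ hτρ hττ hρ hτ hne hsurj hmod hA14 hTUS hV_TUS (by rw [eU, h3]))
    · -- (5,8,1)
      exact absurd hV (no_law_cube_two_parts_of_ordered 1 5 (fun h' hS₀ hS₁ hT₀ hT₁ hU'' hV'' => no_law_cube_15e_of_onto_z11z11 hρρ hρτ hτρ hττ hρ hτ hne hsurj (AddMonoidHom.id (ZMod 11 × ZMod 11)) Function.surjective_id h' hS₀ hS₁ hT₀ hT₁ hU'' hV'') h hS' hT' hU'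
        (Or.inr (Or.inr (Or.inl ⟨h3, h1⟩))))
    · -- (8,1,5)
      exact absurd hV (no_law_cube_two_parts_of_ordered 1 5 (fun h' hS₀ hS₁ hT₀ hT₁ hU'' hV'' => no_law_cube_15e_of_onto_z11z11 hρρ hρτ hτρ hττ hρ hτ hne hsurj (AddMonoidHom.id (ZMod 11 × ZMod 11)) Function.surjective_id h' hS₀ hS₁ hT₀ hT₁ hU'' hV'') h hS' hT' hU'
        (Or.inr (Or.inl ⟨h2, h3⟩)))
    · -- (8,5,1)
      exact absurd hV (no_law_cube_two_parts_of_ordered 1 5 (fun h' hS₀ hS₁ hT₀ hT₁ hU'' hV'' => no_law_cube_15e_of_onto_z11z11 hρρ hρτ hτρ hττ hρ hτ hne hsurj (AddMonoidHom.id (ZMod 11 × ZMod 11)) Function.surjective_id h' hS₀ hS₁ hT₀ hT₁ hU'' hV'') h hS' hT' hU'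
        (Or.inr (Or.inr (Or.inr (Or.inr (Or.inl ⟨h2, h3⟩))))))
    · -- (10,1,4)
      exact absurd hV (no_law_cube_two_parts_of_ordered 1 4 (fun h' hS₀ hS₁ hT₀ hT₁ hU'' hV'' => no_law_cube_14e_of_onto_z11z11 hρρ hρτ hτρ hττ hρ hτ hne hsurj (AddMonoidHom.id (ZMod 11 × ZMod 11)) Function.surjective_id h' hS₀ hS₁ hT₀ hT₁ hU'' hV'') h hS' hT' hU'
        (Or.inr (Or.inl ⟨h2, h3⟩)))
    · -- (10,2,2)
      exact big (card_le_two_mul_addOrderOf_of_mod_one_law_card_four hρρ hρτ hτρ hττ hρ hτ hne hsurj hmod hA14 h hV (by rw [eT, h2]))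
    · -- (10,4,1)
      exact absurd hV (no_law_cube_two_parts_of_ordered 1 4 (fun h' hS₀ hS₁ hT₀ hT₁ hU'' hV'' => no_law_cube_14e_of_onto_z11z11 hρρ hρτ hτρ hττ hρ hτ hne hsurj (AddMonoidHom.id (ZMod 11 × ZMod 11)) Function.surjective_id h' hS₀ hS₁ hT₀ hT₁ hU'' hV'') h hS' hT' hU'
        (Or.inr (Or.inr (Or.inr (Or.inr (Or.inl ⟨h2, h3⟩))))))
    · -- (20,1,2)
      exact big (card_le_two_mul_addOrderOf_of_mod_one_law_card_four hρρ hρτ hτρ hττ hρ hτ hne hsurj hmod hA14 hTUS hV_TUS (by rw [eU, h3]))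
    · -- (20,2,1)
      exact big (card_le_two_mul_addOrderOf_of_mod_one_law_card_four hρρ hρτ hτρ hττ hρ hτ hne hsurj hmod hA14 h hV (by rw [eT, h2]))
    · -- (40,1,1)
      exact big (card_le_two_mul_addOrderOf_of_two_two_law hρρ hρτ hτρ hττ hρ hτ hne hsurj hmod hA7 hTUS (by rw [eT, h2]) (by rw [eU, h3]) hV_TUS)
  · obtain ⟨g, a, b, hab⟩ :=
      two_cosets_of_mod_one_law_of_not_cube hρρ hρτ hτρ hττ hρ hτ hne hsurj hmod hA14 h hV hnc
    exact big ⟨g, card_le_two_mul_addOrderOf_of_two_cosets hab⟩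

end DihedralLike

end Summit.MatrixMultiplication.OmegaCensus
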